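import Literature.NumberTheory.Irrationality.KrattenthalerZudilin2019.ZetaOddMinusPiPowers
import Literature.NumberTheory.Irrationality.Zudilin2003.CatalanRecursion
import HarnessLib

/-!
# Krattenthaler–Zudilin 2019, §2: a creative-telescoping certificate for the family `r̃_n`

Proofs-only companion (file 1 of 3) of `ZetaOddMinusPiPowers.lean`, towards the named facts
`catalanR_eq_catalanRTilde` ("Amazingly, `r_n = r̃_n`") and `catalanRTilde_integrality` (`2^{4n} d_{2n−1}² r̃_n ∈
ℤ + ℤG`, asserted in print without proof: "it is reasonably easy to show … using an argument similar to the one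
in [Zu02b]") of [KrattenthalerZudilin2019, §2] (Kyushu J. Math. **73** (2019)).
ROUTE (cell `pub-zeta5`, seat denom-engine-d2; NOT the printed route via their Theorem 2): with the summand of
`catalanRTilde n = 2^{2n+2} Σ_{u≥0} a_n(u)`, `a_n(u) = (2u+1)(2n+1)! ∏_{j<2n}(u+1−n+j) / ∏_{j<2n+2}(2u−n+½+j)²`,
the sequence `(−1)ⁿ r̃_n` satisfies ZUDILIN'S recursion (2) of [Zudilin2003Catalan] (`Zudilin2003.p`, `.q`)
because of the CREATIVE-TELESCOPING IDENTITY proved here for every `m, u ∈ ℕ`: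
`128·c₊(m)·a_{m+2}(u) + 32·q(m+1)·a_{m+1}(u) − 8·c₋(m)·a_m(u) = V_m(u) − V_m(u+1)`,
`c₊(m) = (2m+3)²(2m+4)² p(m+1)`, `c₋(m) = (2m+1)²(2m+2)² p(m+2)`, with the EXPLICIT rational certificate
`V_m(u) = (2m+2)!·u·Č_m(u)·∏_{i≤2m}(u−m+i) / ((2u−m−3/2)² ∏_{j≤2m+2}(2u−m−½+j)²)`, `Č_m(u) = c₀ + c₂u² + c₄u⁴`
(21 integer coefficients, polynomials in `n = m+1`, displayed in `telescope_succ_pointwise`), and its `n = 0`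
companion `16·a₁(u) + 7·a₀(u) = V⁰(u) − V⁰(u+1)` (`telescope_zero_pointwise`, `V⁰(0) = 13`).  The certificate
is NOT in print: it was FOUND by the seat (Gosper's ansatz solved in exact arithmetic for `n = 1..14`,
interpolated in `n`) and is VERIFIED here by the kernel — after splitting every product over its common core the
identity is one polynomial identity in `(m, u)` closed by `ring` (the shape of `Zudilin2003.lemma2_cleared`).
Files 2–3 (`CatalanRTildeBoundsProofs`, `CatalanRTildeProofs`) add the summability/decay majorants, sum the
identity over `u`, identify `(−1)ⁿ r̃_n` with Zudilin's `F_n = 8(u_nG − v_n)` and discharge the two named facts.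
HONEST FRAMING (cell pub-zeta5): systematic search; identities between explicitly given rational functions;
nothing here concerns the arithmetic nature of Catalan's constant (not known to be irrational).  All helpers are
theorems (no definitions); statement file untouched.
-/
open Finset
open scoped Nat

namespace Literature.NumberTheory.Irrationality.KrattenthalerZudilin2019

namespace CatalanRTilde

open Literature.NumberTheory.Irrationality.Zudilin2003 (p q)

/-! ### Quarter-odd points never vanish -/

/-- `2u + k + ½ ≠ 0` for natural `u` and integer `k` (twice it is an odd integer). [folklore] -/
private theorem two_mul_add_half_ne_zero (u : ℕ) (k : ℤ) : (2 * (u : ℝ) + k + 1 / 2) ≠ 0 := by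
  intro h
  have h2 : ((4 * (u : ℤ) + 2 * k + 1 : ℤ) : ℝ) = 0 := by push_cast; linarith
  have h3 : (4 * (u : ℤ) + 2 * k + 1 : ℤ) = 0 := by exact_mod_cast h2
  omega

/-- Every linear factor `2u − m + c + ½ + j` of the denominators below is nonzero at natural `u`
(`m, j ∈ ℕ`, `c ∈ ℤ`). [folklore] -/
private theorem den_ne_zero (u m j : ℕ) (c : ℤ) : (2 * (u : ℝ) - m + c + 1 / 2 + j) ≠ 0 := by
  have := two_mul_add_half_ne_zero u (-(m : ℤ) + c + j)
  push_cast at this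
  convert this using 1
  ring

/-! ### Splitting the products over their common cores -/

/-- The numerator product of the summand at index `m+1`, split as (bottom factor) · (core of index `m`) ·
(top factor). [folklore] -/
private theorem numA1 (m : ℕ) (x : ℝ) :
    ∏ j ∈ range (2 * (m + 1)), (x + 1 - ((m + 1 : ℕ) : ℝ) + j)
      = (x - m) * (∏ j ∈ range (2 * m), (x + 1 - m + j)) * (x + m + 1) := by
  rw [show 2 * (m + 1) = 2 * m + 1 + 1 by ring, prod_range_succ, prod_range_succ']
  push_cast
  have h : ∏ k ∈ range (2 * m), (x + 1 - ((m : ℝ) + 1) + ((k : ℝ) + 1))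
      = ∏ j ∈ range (2 * m), (x + 1 - m + j) := prod_congr rfl fun j _ => by ring
  rw [h]
  ring

/-- The denominator product of the summand at index `m`, split off its bottom factor. [folklore] -/
private theorem denA0 (m : ℕ) (x : ℝ) :
    ∏ j ∈ range (2 * m + 2), (2 * x - m + 1 / 2 + j) ^ 2
      = (2 * x - m + 1 / 2) ^ 2 * (∏ j ∈ range (2 * m + 1), (2 * x - m + 3 / 2 + j)) ^ 2 := by
  rw [prod_range_succ', ← prod_pow]
  push_cast
  have h : ∏ k ∈ range (2 * m + 1), (2 * x - m + 1 / 2 + ((k : ℝ) + 1)) ^ 2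
      = ∏ j ∈ range (2 * m + 1), (2 * x - m + 3 / 2 + j) ^ 2 := prod_congr rfl fun j _ => by ring
  rw [h]
  ring

/-- The denominator product of the summand at index `m+1` over the core of index `m`. [folklore] -/
private theorem denA1 (m : ℕ) (x : ℝ) :
    ∏ j ∈ range (2 * (m + 1) + 2), (2 * x - ((m + 1 : ℕ) : ℝ) + 1 / 2 + j) ^ 2
      = (2 * x - m - 1 / 2) ^ 2 * (2 * x - m + 1 / 2) ^ 2
          * (∏ j ∈ range (2 * m + 1), (2 * x - m + 3 / 2 + j)) ^ 2 * (2 * x + m + 5 / 2) ^ 2 := by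
  rw [show 2 * (m + 1) + 2 = 2 * m + 1 + 1 + 1 + 1 by ring, prod_range_succ, prod_range_succ',
    prod_range_succ', ← prod_pow]
  push_cast
  have h : ∏ k ∈ range (2 * m + 1), (2 * x - ((m : ℝ) + 1) + 1 / 2 + ((k : ℝ) + 1 + 1)) ^ 2
      = ∏ j ∈ range (2 * m + 1), (2 * x - m + 3 / 2 + j) ^ 2 := prod_congr rfl fun j _ => by ring
  rw [h]
  ring

/-- The numerator product of the summand at index `m+2` over the core of index `m`. [folklore] -/
private theorem numA2 (m : ℕ) (x : ℝ) :
    ∏ j ∈ range (2 * (m + 2)), (x + 1 - ((m + 2 : ℕ) : ℝ) + j)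
      = (x - m - 1) * (x - m) * (∏ j ∈ range (2 * m), (x + 1 - m + j)) * (x + m + 1) * (x + m + 2) := by
  rw [show 2 * (m + 2) = 2 * m + 1 + 1 + 1 + 1 by ring, prod_range_succ, prod_range_succ,
    prod_range_succ', prod_range_succ']
  push_cast
  have h : ∏ k ∈ range (2 * m), (x + 1 - ((m : ℝ) + 2) + ((k : ℝ) + 1 + 1))
      = ∏ j ∈ range (2 * m), (x + 1 - m + j) := prod_congr rfl fun j _ => by ring
  rw [h]
  ring

/-- The denominator product of the summand at index `m+2` over the core of index `m`. [folklore] -/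
private theorem denA2 (m : ℕ) (x : ℝ) :
    ∏ j ∈ range (2 * (m + 2) + 2), (2 * x - ((m + 2 : ℕ) : ℝ) + 1 / 2 + j) ^ 2
      = (2 * x - m - 3 / 2) ^ 2 * (2 * x - m - 1 / 2) ^ 2 * (2 * x - m + 1 / 2) ^ 2
          * (∏ j ∈ range (2 * m + 1), (2 * x - m + 3 / 2 + j)) ^ 2
          * (2 * x + m + 5 / 2) ^ 2 * (2 * x + m + 7 / 2) ^ 2 := by
  rw [show 2 * (m + 2) + 2 = 2 * m + 1 + 1 + 1 + 1 + 1 + 1 by ring, prod_range_succ, prod_range_succ,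
    prod_range_succ', prod_range_succ', prod_range_succ', ← prod_pow]
  push_cast
  have h : ∏ k ∈ range (2 * m + 1), (2 * x - ((m : ℝ) + 2) + 1 / 2 + ((k : ℝ) + 1 + 1 + 1)) ^ 2
      = ∏ j ∈ range (2 * m + 1), (2 * x - m + 3 / 2 + j) ^ 2 := prod_congr rfl fun j _ => by ring
  rw [h]
  ring

/-- The numerator product of the certificate at `u` over the core of index `m`. [folklore] -/
private theorem numV0 (m : ℕ) (x : ℝ) :
    ∏ i ∈ range (2 * m + 1), (x - m + i) = (x - m) * ∏ j ∈ range (2 * m), (x + 1 - m + j) := by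
  rw [prod_range_succ']
  push_cast
  have h : ∏ k ∈ range (2 * m), (x - m + ((k : ℝ) + 1)) = ∏ j ∈ range (2 * m), (x + 1 - m + j) :=
    prod_congr rfl fun j _ => by ring
  rw [h]
  ring

/-- The denominator product of the certificate at `u` over the core of index `m`. [folklore] -/
private theorem denV0 (m : ℕ) (x : ℝ) :
    ∏ j ∈ range (2 * m + 3), (2 * x - m - 1 / 2 + j) ^ 2
      = (2 * x - m - 1 / 2) ^ 2 * (2 * x - m + 1 / 2) ^ 2
          * (∏ j ∈ range (2 * m + 1), (2 * x - m + 3 / 2 + j)) ^ 2 := by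
  rw [show 2 * m + 3 = 2 * m + 1 + 1 + 1 by ring, prod_range_succ', prod_range_succ', ← prod_pow]
  push_cast
  have h : ∏ k ∈ range (2 * m + 1), (2 * x - m - 1 / 2 + ((k : ℝ) + 1 + 1)) ^ 2
      = ∏ j ∈ range (2 * m + 1), (2 * x - m + 3 / 2 + j) ^ 2 := prod_congr rfl fun j _ => by ring
  rw [h]
  ring

/-- The numerator product of the certificate at `u+1` over the core of index `m`. [folklore] -/
private theorem numV1 (m : ℕ) (x : ℝ) :
    ∏ i ∈ range (2 * m + 1), (x + 1 - m + i) = (∏ j ∈ range (2 * m), (x + 1 - m + j)) * (x + m + 1) := by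
  rw [prod_range_succ]
  push_cast
  ring

/-- The denominator product of the certificate at `u+1` over the core of index `m`. [folklore] -/
private theorem denV1 (m : ℕ) (x : ℝ) :
    ∏ j ∈ range (2 * m + 3), (2 * (x + 1) - m - 1 / 2 + j) ^ 2
      = (∏ j ∈ range (2 * m + 1), (2 * x - m + 3 / 2 + j)) ^ 2
          * (2 * x + m + 5 / 2) ^ 2 * (2 * x + m + 7 / 2) ^ 2 := by
  rw [show 2 * m + 3 = 2 * m + 1 + 1 + 1 by ring, prod_range_succ, prod_range_succ, ← prod_pow]
  push_cast
  have h : ∏ k ∈ range (2 * m + 1), (2 * (x + 1) - m - 1 / 2 + (k : ℝ)) ^ 2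
      = ∏ j ∈ range (2 * m + 1), (2 * x - m + 3 / 2 + j) ^ 2 := prod_congr rfl fun j _ => by ring
  rw [h]
  ring

/-! ### The telescoping identity for `n = m + 1 ≥ 1` -/

/-- **Creative-telescoping identity for the `r̃_n` summands** (all `m u : ℕ`; `n = m+1`): with the summand
`a_k(u) = (2u+1)(2k+1)!∏_{j<2k}(u+1−k+j)/∏_{j<2k+2}(2u−k+½+j)²` of `catalanRTilde k` written out for
`k = m+2, m+1, m` exactly as the definition unfolds, and the coefficients of Zudilin's recursion (2) in the cast
form of `Zudilin2003.F_rec`,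
`128·(2m+3)²(2m+4)²p(m+1)·a_{m+2}(u) + 32·q(m+1)·a_{m+1}(u) − 8·(2m+1)²(2m+2)²p(m+2)·a_m(u) = V_m(u) − V_m(u+1)`
for the explicit certificate `V_m` displayed on the right (a rational function of `u` with the numerator factor
`u`, so `V_m(0) = 0`).  Certificate found by the cell (not in print); the identity is what makes `(−1)ⁿr̃_n`
satisfy [Zudilin2003Catalan, eq. (2)].
[cite: KrattenthalerZudilin2019, §2 (the family r̃_n)] -/
theorem telescope_succ_pointwise (m u : ℕ) :
    128 * ((2 * ((m : ℝ) + 1) + 1) ^ 2 * (2 * ((m : ℝ) + 1) + 2) ^ 2 * ((p ((m : ℚ) + 1) : ℚ) : ℝ))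
        * ((2 * (u : ℝ) + 1) * ((2 * (m + 2) + 1)! : ℝ)
            * (∏ j ∈ range (2 * (m + 2)), ((u : ℝ) + 1 - ((m + 2 : ℕ) : ℝ) + j))
            / ∏ j ∈ range (2 * (m + 2) + 2), (2 * (u : ℝ) - ((m + 2 : ℕ) : ℝ) + 1 / 2 + j) ^ 2)
      + 32 * ((q ((m : ℚ) + 1) : ℚ) : ℝ)
        * ((2 * (u : ℝ) + 1) * ((2 * (m + 1) + 1)! : ℝ)
            * (∏ j ∈ range (2 * (m + 1)), ((u : ℝ) + 1 - ((m + 1 : ℕ) : ℝ) + j))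
            / ∏ j ∈ range (2 * (m + 1) + 2), (2 * (u : ℝ) - ((m + 1 : ℕ) : ℝ) + 1 / 2 + j) ^ 2)
      - 8 * ((2 * ((m : ℝ) + 1) - 1) ^ 2 * (2 * ((m : ℝ) + 1)) ^ 2 * ((p ((m : ℚ) + 1 + 1) : ℚ) : ℝ))
        * ((2 * (u : ℝ) + 1) * ((2 * m + 1)! : ℝ)
            * (∏ j ∈ range (2 * m), ((u : ℝ) + 1 - (m : ℝ) + j))
            / ∏ j ∈ range (2 * m + 2), (2 * (u : ℝ) - (m : ℝ) + 1 / 2 + j) ^ 2)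
    = (fun v : ℕ => ((2 * m + 2)! : ℝ) * (v : ℝ)
          * ((13 - 20 * ((m : ℝ) + 1) - 1632 * ((m : ℝ) + 1) ^ 2 + 976 * ((m : ℝ) + 1) ^ 3
                + 23520 * ((m : ℝ) + 1) ^ 4 + 3392 * ((m : ℝ) + 1) ^ 5 - 141824 * ((m : ℝ) + 1) ^ 6
                - 224512 * ((m : ℝ) + 1) ^ 7 - 101120 * ((m : ℝ) + 1) ^ 8)
              + (640 + 512 * ((m : ℝ) + 1) + 768 * ((m : ℝ) + 1) ^ 2 - 37888 * ((m : ℝ) + 1) ^ 3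
                + 49152 * ((m : ℝ) + 1) ^ 4 + 299008 * ((m : ℝ) + 1) ^ 5
                + 225280 * ((m : ℝ) + 1) ^ 6) * (v : ℝ) ^ 2
              + (-3328 + 5120 * ((m : ℝ) + 1) + 14336 * ((m : ℝ) + 1) ^ 2 - 12288 * ((m : ℝ) + 1) ^ 3
                - 20480 * ((m : ℝ) + 1) ^ 4) * (v : ℝ) ^ 4)
          * (∏ i ∈ range (2 * m + 1), ((v : ℝ) - m + i))
          / ((2 * (v : ℝ) - m - 3 / 2) ^ 2
              * ∏ j ∈ range (2 * m + 3), (2 * (v : ℝ) - m - 1 / 2 + j) ^ 2)) u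
      - (fun v : ℕ => ((2 * m + 2)! : ℝ) * (v : ℝ)
          * ((13 - 20 * ((m : ℝ) + 1) - 1632 * ((m : ℝ) + 1) ^ 2 + 976 * ((m : ℝ) + 1) ^ 3
                + 23520 * ((m : ℝ) + 1) ^ 4 + 3392 * ((m : ℝ) + 1) ^ 5 - 141824 * ((m : ℝ) + 1) ^ 6
                - 224512 * ((m : ℝ) + 1) ^ 7 - 101120 * ((m : ℝ) + 1) ^ 8)
              + (640 + 512 * ((m : ℝ) + 1) + 768 * ((m : ℝ) + 1) ^ 2 - 37888 * ((m : ℝ) + 1) ^ 3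
                + 49152 * ((m : ℝ) + 1) ^ 4 + 299008 * ((m : ℝ) + 1) ^ 5
                + 225280 * ((m : ℝ) + 1) ^ 6) * (v : ℝ) ^ 2
              + (-3328 + 5120 * ((m : ℝ) + 1) + 14336 * ((m : ℝ) + 1) ^ 2 - 12288 * ((m : ℝ) + 1) ^ 3
                - 20480 * ((m : ℝ) + 1) ^ 4) * (v : ℝ) ^ 4)
          * (∏ i ∈ range (2 * m + 1), ((v : ℝ) - m + i))
          / ((2 * (v : ℝ) - m - 3 / 2) ^ 2
              * ∏ j ∈ range (2 * m + 3), (2 * (v : ℝ) - m - 1 / 2 + j) ^ 2)) (u + 1) := by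
  -- beta-reduce and name the atoms
  dsimp only
  have hu1 : (((u + 1 : ℕ) : ℝ)) = (u : ℝ) + 1 := by push_cast; ring
  rw [hu1, numA2 m, denA2 m, numA1 m, denA1 m, denA0 m, numV0 m, denV0 m, numV1 m, denV1 m]
  set x : ℝ := (u : ℝ) with hx
  set mr : ℝ := (m : ℝ) with hmr
  set B : ℝ := ∏ j ∈ range (2 * m), (x + 1 - mr + j) with hB
  set G : ℝ := ∏ j ∈ range (2 * m + 1), (2 * x - mr + 3 / 2 + j) with hG
  set F : ℝ := ((2 * m + 1)! : ℝ) with hF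
  set C0 : ℝ := (13 - 20 * (mr + 1) - 1632 * (mr + 1) ^ 2 + 976 * (mr + 1) ^ 3
                + 23520 * (mr + 1) ^ 4 + 3392 * (mr + 1) ^ 5 - 141824 * (mr + 1) ^ 6
                - 224512 * (mr + 1) ^ 7 - 101120 * (mr + 1) ^ 8) with hC0
  set C2 : ℝ := (640 + 512 * (mr + 1) + 768 * (mr + 1) ^ 2 - 37888 * (mr + 1) ^ 3
                + 49152 * (mr + 1) ^ 4 + 299008 * (mr + 1) ^ 5 + 225280 * (mr + 1) ^ 6) with hC2
  set C4 : ℝ := (-3328 + 5120 * (mr + 1) + 14336 * (mr + 1) ^ 2 - 12288 * (mr + 1) ^ 3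
                - 20480 * (mr + 1) ^ 4) with hC4
  -- nonvanishing of the quarter-odd linear factors and of `G`
  have hd1 : (2 * x - mr - 3 / 2) ≠ 0 := by
    have := den_ne_zero u m 0 (-2); push_cast at this; convert this using 1; rw [hx, hmr]; ring
  have hd2 : (2 * x - mr - 1 / 2) ≠ 0 := by
    have := den_ne_zero u m 0 (-1); push_cast at this; convert this using 1; rw [hx, hmr]; ring
  have hd3 : (2 * x - mr + 1 / 2) ≠ 0 := by
    have := den_ne_zero u m 0 0; push_cast at this; convert this using 1; rw [hx, hmr]; ring
  have hd4 : (2 * x + mr + 5 / 2) ≠ 0 := by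
    have := den_ne_zero u 0 m 2; push_cast at this; convert this using 1; rw [hx, hmr]; ring
  have hd5 : (2 * x + mr + 7 / 2) ≠ 0 := by
    have := den_ne_zero u 0 m 3; push_cast at this; convert this using 1; rw [hx, hmr]; ring
  have hGne : G ≠ 0 := by
    rw [hG]
    refine prod_ne_zero_iff.mpr fun j _ => ?_
    have := den_ne_zero u m j 1; push_cast at this; convert this using 1; rw [hx, hmr]; ring
  -- factorials
  have hF2 : ((2 * m + 2)! : ℝ) = (2 * mr + 2) * F := by
    rw [hF, hmr, show 2 * m + 2 = (2 * m + 1) + 1 by ring, Nat.factorial_succ]; push_cast; ring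
  have hF3 : ((2 * (m + 1) + 1)! : ℝ) = (2 * mr + 3) * (2 * mr + 2) * F := by
    rw [hF, hmr, show 2 * (m + 1) + 1 = (2 * m + 1) + 1 + 1 by ring, Nat.factorial_succ,
      Nat.factorial_succ]; push_cast; ring
  have hF5 : ((2 * (m + 2) + 1)! : ℝ)
      = (2 * mr + 5) * (2 * mr + 4) * (2 * mr + 3) * (2 * mr + 2) * F := by
    rw [hF, hmr, show 2 * (m + 2) + 1 = (2 * m + 1) + 1 + 1 + 1 + 1 by ring, Nat.factorial_succ,
      Nat.factorial_succ, Nat.factorial_succ, Nat.factorial_succ]; push_cast; ring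
  rw [hF2, hF3, hF5]
  -- coefficient casts
  have hp1 : ((p ((m : ℚ) + 1) : ℚ) : ℝ) = p (mr + 1) := by unfold p; push_cast; rw [hmr]
  have hp2 : ((p ((m : ℚ) + 1 + 1) : ℚ) : ℝ) = p (mr + 1 + 1) := by unfold p; push_cast; rw [hmr]
  have hq1 : ((q ((m : ℚ) + 1) : ℚ) : ℝ) = q (mr + 1) := by unfold q; push_cast; rw [hmr]
  rw [hp1, hp2, hq1]
  -- the common denominator
  set L : ℝ := (2 * x - mr - 3 / 2) ^ 2 * (2 * x - mr - 1 / 2) ^ 2 * (2 * x - mr + 1 / 2) ^ 2 * G ^ 2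
      * (2 * x + mr + 5 / 2) ^ 2 * (2 * x + mr + 7 / 2) ^ 2 with hL
  have hLne : L ≠ 0 := by
    rw [hL]
    exact mul_ne_zero (mul_ne_zero (mul_ne_zero (mul_ne_zero (mul_ne_zero (pow_ne_zero _ hd1)
      (pow_ne_zero _ hd2)) (pow_ne_zero _ hd3)) (pow_ne_zero _ hGne)) (pow_ne_zero _ hd4))
      (pow_ne_zero _ hd5)
  -- each of the five terms over the common denominator `L`
  have t2 : (2 * x + 1) * ((2 * mr + 5) * (2 * mr + 4) * (2 * mr + 3) * (2 * mr + 2) * F)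
        * ((x - mr - 1) * (x - mr) * B * (x + mr + 1) * (x + mr + 2))
        / ((2 * x - mr - 3 / 2) ^ 2 * (2 * x - mr - 1 / 2) ^ 2 * (2 * x - mr + 1 / 2) ^ 2 * G ^ 2
            * (2 * x + mr + 5 / 2) ^ 2 * (2 * x + mr + 7 / 2) ^ 2)
      = ((2 * x + 1) * (2 * mr + 2) * (2 * mr + 3) * (2 * mr + 4) * (2 * mr + 5)
          * (x - mr - 1) * (x - mr) * (x + mr + 1) * (x + mr + 2)) * (F * B) / L := by
    rw [hL, div_eq_div_iff hLne hLne]; ring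
  have t1 : (2 * x + 1) * ((2 * mr + 3) * (2 * mr + 2) * F) * ((x - mr) * B * (x + mr + 1))
        / ((2 * x - mr - 1 / 2) ^ 2 * (2 * x - mr + 1 / 2) ^ 2 * G ^ 2 * (2 * x + mr + 5 / 2) ^ 2)
      = ((2 * x + 1) * (2 * mr + 2) * (2 * mr + 3) * (x - mr) * (x + mr + 1)
          * (2 * x - mr - 3 / 2) ^ 2 * (2 * x + mr + 7 / 2) ^ 2) * (F * B) / L := by
    rw [hL, div_eq_div_iff (mul_ne_zero (mul_ne_zero (mul_ne_zero (pow_ne_zero _ hd2) (pow_ne_zero _ hd3))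
      (pow_ne_zero _ hGne)) (pow_ne_zero _ hd4)) hLne]; ring
  have t0 : (2 * x + 1) * F * B / ((2 * x - mr + 1 / 2) ^ 2 * G ^ 2)
      = ((2 * x + 1) * (2 * x - mr - 3 / 2) ^ 2 * (2 * x - mr - 1 / 2) ^ 2 * (2 * x + mr + 5 / 2) ^ 2
            * (2 * x + mr + 7 / 2) ^ 2) * (F * B) / L := by
    rw [hL, div_eq_div_iff (mul_ne_zero (pow_ne_zero _ hd3) (pow_ne_zero _ hGne)) hLne]; ring
  have v0 : (2 * mr + 2) * F * x * (C0 + C2 * x ^ 2 + C4 * x ^ 4) * ((x - mr) * B)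
        / ((2 * x - mr - 3 / 2) ^ 2
            * ((2 * x - mr - 1 / 2) ^ 2 * (2 * x - mr + 1 / 2) ^ 2 * G ^ 2))
      = ((2 * mr + 2) * (x * (C0 + C2 * x ^ 2 + C4 * x ^ 4) * (x - mr) * (2 * x + mr + 5 / 2) ^ 2
          * (2 * x + mr + 7 / 2) ^ 2)) * (F * B) / L := by
    rw [hL, div_eq_div_iff (mul_ne_zero (pow_ne_zero _ hd1) (mul_ne_zero (mul_ne_zero (pow_ne_zero _ hd2)
      (pow_ne_zero _ hd3)) (pow_ne_zero _ hGne))) hLne]; ring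
  have v1 : (2 * mr + 2) * F * (x + 1) * (C0 + C2 * (x + 1) ^ 2 + C4 * (x + 1) ^ 4) * (B * (x + mr + 1))
        / ((2 * (x + 1) - mr - 3 / 2) ^ 2 * (G ^ 2 * (2 * x + mr + 5 / 2) ^ 2 * (2 * x + mr + 7 / 2) ^ 2))
      = ((2 * mr + 2) * ((x + 1) * (C0 + C2 * (x + 1) ^ 2 + C4 * (x + 1) ^ 4) * (x + mr + 1)
          * (2 * x - mr - 3 / 2) ^ 2 * (2 * x - mr - 1 / 2) ^ 2)) * (F * B) / L := by
    have h' : (2 * (x + 1) - mr - 3 / 2) = 2 * x - mr + 1 / 2 := by ring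
    rw [h', hL, div_eq_div_iff (mul_ne_zero (pow_ne_zero _ hd3) (mul_ne_zero (mul_ne_zero (pow_ne_zero _ hGne)
      (pow_ne_zero _ hd4)) (pow_ne_zero _ hd5))) hLne]; ring
  rw [t2, t1, t0, v0, v1]
  -- the cleared polynomial identity
  have key : 128 * ((2 * (mr + 1) + 1) ^ 2 * (2 * (mr + 1) + 2) ^ 2 * p (mr + 1))
        * ((2 * x + 1) * (2 * mr + 2) * (2 * mr + 3) * (2 * mr + 4) * (2 * mr + 5)
          * (x - mr - 1) * (x - mr) * (x + mr + 1) * (x + mr + 2))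
      + 32 * q (mr + 1) * ((2 * x + 1) * (2 * mr + 2) * (2 * mr + 3) * (x - mr) * (x + mr + 1)
          * (2 * x - mr - 3 / 2) ^ 2 * (2 * x + mr + 7 / 2) ^ 2)
      - 8 * ((2 * (mr + 1) - 1) ^ 2 * (2 * (mr + 1)) ^ 2 * p (mr + 1 + 1))
          * ((2 * x + 1) * (2 * x - mr - 3 / 2) ^ 2 * (2 * x - mr - 1 / 2) ^ 2 * (2 * x + mr + 5 / 2) ^ 2
            * (2 * x + mr + 7 / 2) ^ 2)
    = (2 * mr + 2) *
      (x * (C0 + C2 * x ^ 2 + C4 * x ^ 4) * (x - mr) * (2 * x + mr + 5 / 2) ^ 2 * (2 * x + mr + 7 / 2) ^ 2)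
      - (2 * mr + 2) * ((x + 1) * (C0 + C2 * (x + 1) ^ 2 + C4 * (x + 1) ^ 4)
          * (x + mr + 1) * (2 * x - mr - 3 / 2) ^ 2 * (2 * x - mr - 1 / 2) ^ 2) := by
    rw [hC0, hC2, hC4]
    unfold p q
    ring
  have e : ∀ P2 P1 P0 Q0 Q1 cp cq cm : ℝ, 128 * cp * P2 + 32 * cq * P1 - 8 * cm * P0 = Q0 - Q1 →
      128 * cp * (P2 * (F * B) / L) + 32 * cq * (P1 * (F * B) / L) - 8 * cm * (P0 * (F * B) / L)
        = Q0 * (F * B) / L - Q1 * (F * B) / L := by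
    intro P2 P1 P0 Q0 Q1 cp cq cm h
    have : Q0 = 128 * cp * P2 + 32 * cq * P1 - 8 * cm * P0 + Q1 := by linarith
    rw [this]; ring
  exact e _ _ _ _ _ _ _ _ key

/-! ### The companion identity at `n = 0` -/

/-- **The `n = 0` companion** (all `u : ℕ`): with `a₁(u) = (2u+1)·3!·u(u+1)/((2u−½)(2u+½)(2u+3/2)(2u+5/2))²`
and `a₀(u) = (2u+1)/((2u+½)(2u+3/2))²` (the summands of `catalanRTilde 1`, `catalanRTilde 0`),
`16·a₁(u) + 7·a₀(u) = V⁰(u) − V⁰(u+1)` with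
`V⁰(u) = 2(14u⁴ + 21u³ + 19u²/2 + 39u/16 + 117/128)/((2u−½)²(2u+½)²(2u+3/2)²)`, `V⁰(0) = 13`; this is the
degenerate case `4x₁ − 7x₀ = −13/2` of the recursion (2) (whose `x_{−1}`-coefficient `(2n−1)²(2n)²p(n+1)`
vanishes at `n = 0`), and it yields `r̃₁ = 13 − 14G` from `r̃₀ = 8G`.  Certificate found by the cell.
[cite: KrattenthalerZudilin2019, §2 (the family r̃_n)] -/
theorem telescope_zero_pointwise (u : ℕ) :
    16 * ((2 * (u : ℝ) + 1) * 6 * ((u : ℝ) * ((u : ℝ) + 1))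
          / ((2 * (u : ℝ) - 1 / 2) ^ 2 * (2 * (u : ℝ) + 1 / 2) ^ 2 * (2 * (u : ℝ) + 3 / 2) ^ 2
              * (2 * (u : ℝ) + 5 / 2) ^ 2))
      + 7 * ((2 * (u : ℝ) + 1) / ((2 * (u : ℝ) + 1 / 2) ^ 2 * (2 * (u : ℝ) + 3 / 2) ^ 2))
    = (fun v : ℕ => 2 * (14 * (v : ℝ) ^ 4 + 21 * (v : ℝ) ^ 3 + 19 / 2 * (v : ℝ) ^ 2 + 39 / 16 * (v : ℝ)
            + 117 / 128)
          / ((2 * (v : ℝ) - 1 / 2) ^ 2 * (2 * (v : ℝ) + 1 / 2) ^ 2 * (2 * (v : ℝ) + 3 / 2) ^ 2)) u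
      - (fun v : ℕ => 2 * (14 * (v : ℝ) ^ 4 + 21 * (v : ℝ) ^ 3 + 19 / 2 * (v : ℝ) ^ 2 + 39 / 16 * (v : ℝ)
            + 117 / 128)
          / ((2 * (v : ℝ) - 1 / 2) ^ 2 * (2 * (v : ℝ) + 1 / 2) ^ 2 * (2 * (v : ℝ) + 3 / 2) ^ 2)) (u + 1) := by
  dsimp only
  have h1 : (2 * (u : ℝ) - 1 / 2) ≠ 0 := by
    have := den_ne_zero u 1 0 0; push_cast at this; convert this using 1; ring
  have h2 : (2 * (u : ℝ) + 1 / 2) ≠ 0 := by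
    have := den_ne_zero u 0 0 0; push_cast at this; convert this using 1; ring
  have h3 : (2 * (u : ℝ) + 3 / 2) ≠ 0 := by
    have := den_ne_zero u 0 1 0; push_cast at this; convert this using 1; ring
  have h4 : (2 * (u : ℝ) + 5 / 2) ≠ 0 := by
    have := den_ne_zero u 0 2 0; push_cast at this; convert this using 1; ring
  have h5 : (2 * (u : ℝ) + 7 / 2) ≠ 0 := by
    have := den_ne_zero u 0 3 0; push_cast at this; convert this using 1; ring
  have hu1 : (((u + 1 : ℕ) : ℝ)) = (u : ℝ) + 1 := by push_cast; ring
  rw [hu1]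
  have e1 : (2 * ((u : ℝ) + 1) - 1 / 2) = 2 * (u : ℝ) + 3 / 2 := by ring
  have e2 : (2 * ((u : ℝ) + 1) + 1 / 2) = 2 * (u : ℝ) + 5 / 2 := by ring
  have e3 : (2 * ((u : ℝ) + 1) + 3 / 2) = 2 * (u : ℝ) + 7 / 2 := by ring
  rw [e1, e2, e3]
  set x : ℝ := (u : ℝ) with hx
  set L : ℝ := (2 * x - 1 / 2) ^ 2 * (2 * x + 1 / 2) ^ 2 * (2 * x + 3 / 2) ^ 2 * (2 * x + 5 / 2) ^ 2
      * (2 * x + 7 / 2) ^ 2 with hL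
  have hLne : L ≠ 0 :=
    mul_ne_zero (mul_ne_zero (mul_ne_zero (mul_ne_zero (pow_ne_zero _ h1) (pow_ne_zero _ h2))
      (pow_ne_zero _ h3)) (pow_ne_zero _ h4)) (pow_ne_zero _ h5)
  have t1 : (2 * x + 1) * 6 * (x * (x + 1))
        / ((2 * x - 1 / 2) ^ 2 * (2 * x + 1 / 2) ^ 2 * (2 * x + 3 / 2) ^ 2 * (2 * x + 5 / 2) ^ 2)
      = (2 * x + 1) * 6 * (x * (x + 1)) * (2 * x + 7 / 2) ^ 2 / L := by
    rw [hL, div_eq_div_iff (mul_ne_zero (mul_ne_zero (mul_ne_zero (pow_ne_zero _ h1) (pow_ne_zero _ h2))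
      (pow_ne_zero _ h3)) (pow_ne_zero _ h4)) hLne]
    ring
  have t0 : (2 * x + 1) / ((2 * x + 1 / 2) ^ 2 * (2 * x + 3 / 2) ^ 2)
      = (2 * x + 1) * (2 * x - 1 / 2) ^ 2 * (2 * x + 5 / 2) ^ 2 * (2 * x + 7 / 2) ^ 2 / L := by
    rw [hL, div_eq_div_iff (mul_ne_zero (pow_ne_zero _ h2) (pow_ne_zero _ h3)) hLne]
    ring
  have v0 : 2 * (14 * x ^ 4 + 21 * x ^ 3 + 19 / 2 * x ^ 2 + 39 / 16 * x + 117 / 128)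
        / ((2 * x - 1 / 2) ^ 2 * (2 * x + 1 / 2) ^ 2 * (2 * x + 3 / 2) ^ 2)
      = 2 * (14 * x ^ 4 + 21 * x ^ 3 + 19 / 2 * x ^ 2 + 39 / 16 * x + 117 / 128)
          * (2 * x + 5 / 2) ^ 2 * (2 * x + 7 / 2) ^ 2 / L := by
    rw [hL, div_eq_div_iff (mul_ne_zero (mul_ne_zero (pow_ne_zero _ h1) (pow_ne_zero _ h2))
      (pow_ne_zero _ h3)) hLne]
    ring
  have v1 : 2 * (14 * (x + 1) ^ 4 + 21 * (x + 1) ^ 3 + 19 / 2 * (x + 1) ^ 2 + 39 / 16 * (x + 1) + 117 / 128)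
        / ((2 * x + 3 / 2) ^ 2 * (2 * x + 5 / 2) ^ 2 * (2 * x + 7 / 2) ^ 2)
      = 2 * (14 * (x + 1) ^ 4 + 21 * (x + 1) ^ 3 + 19 / 2 * (x + 1) ^ 2 + 39 / 16 * (x + 1) + 117 / 128)
          * (2 * x - 1 / 2) ^ 2 * (2 * x + 1 / 2) ^ 2 / L := by
    rw [hL, div_eq_div_iff (mul_ne_zero (mul_ne_zero (pow_ne_zero _ h3) (pow_ne_zero _ h4))
      (pow_ne_zero _ h5)) hLne]
    ring
  rw [t1, t0, v0, v1]
  have e : ∀ A B C D : ℝ, 16 * A + 7 * B = C - D → 16 * (A / L) + 7 * (B / L) = C / L - D / L := by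
    intro A B C D h
    rw [← sub_eq_zero]
    have : 16 * (A / L) + 7 * (B / L) - (C / L - D / L) = (16 * A + 7 * B - (C - D)) / L := by ring
    rw [this, h, sub_self, zero_div]
  exact e _ _ _ _ (by ring)

end CatalanRTilde

end Literature.NumberTheory.Irrationality.KrattenthalerZudilin2019
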